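import Summits.NavierStokesRegularity.NavierStokesRegularity.Theses.RellichScar
import Summits.NavierStokesRegularity.NavierStokesRegularity.Theorems.SymmetricScarExists.Negative.SpiralWorld
import Summits.NavierStokesRegularity.NavierStokesRegularity.Theorems.SymmetricScarExists.Negative.ConclusionLoadBearing

/-!
# `SymmetricScarExists`, line `analytic-scar-window-rigidity` — lemmas for the stub
# `stub_scarDefectLimit` (crux stmt-NavierStokesRegularity-11718, route RellichScar)

Generic half of the proof that scar defects pass to `L³_loc` limits of apex profiles (file
`RellichScarSymmetricScarExistsScarDefectLimit.lean`).  Everything here is elementary measure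
theory / topology on the open backward slab `t < 0` of `ℝ × ℝ³`:

* `norm_le_of_ae_enorm_le` — ESS-SUP BOUND + CONTINUITY ⇒ POINTWISE BOUND on open boxes;
* `static_limit_eq_zero_of_flat` — fields `F j`, continuous on the open slab, with static traces
  `τ j` at the uniform cubic rate `‖F j(t,x) − τ j(x)‖ ≤ M(−t)/‖x‖³` and `τ j → τl` pointwise:
  if `‖F j‖_{L^∞((−δ,0)×K)}` is eventually (in `j`) small for all small `δ`, every compact
  `K ∌ 0`, then `τl = 0` off the origin (`t ↑ 0`, then `j → ∞`);
* `tendsto_static_of_tendsto` — pointwise convergence of fields with traces at a uniform cubic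
  rate is pointwise convergence of the traces;
* `tendsto_eLpNorm_top_of_rate` — a cubic rate `‖D(t,x)‖ ≤ M(−t)/‖x‖³` makes the scar functional
  `‖D‖_{L^∞((−δ,0)×K)} ≤ Mδ/ρ³` tend to `0`;
* `eLpNorm_scar_congr_ae`, `sameScar_congr_ae` — the scar functional and `SameScar` only see the
  slab up to null sets;
* `sameScar_of_flat_defect` — the ABSTRACT DEFECT-LIMIT LEMMA (registered sub-goal): for an
  operation `T` on fields with induced operation `T'` on static fields (preserving continuity on
  the slab, transporting the cubic trace rate, `T'` continuous for pointwise convergence off the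
  origin), asymptotic flatness of the `T`-defects `T(W j) − W j` along `W j → U` (traces
  `σ j → σU`) forces `T' σU = σU` off the origin and hence `SameScar (T U) U`.

References (for the setting only; the lemmas are folklore): G. Koch, N. Nadirashvili, G. Seregin,
V. Šverák, Acta Math. 203 (2009), §1 (1.6) and §4 [KochNadirashviliSereginSverak2009].
-/

noncomputable section

open MeasureTheory Set Function Filter Topology TopologicalSpace Metric
open scoped NNReal ENNReal

namespace Summit.NavierStokesRegularity.NavierStokesRegularity.Theorems.SymmetricScarExists.ScarWindow

open Literature.Analysis.FluidPDE
open Summit.NavierStokesRegularity.NavierStokesRegularity.Theses.RellichScar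
open Summit.NavierStokesRegularity.NavierStokesRegularity.Theorems.SymmetricScarExists.Negative

set_option linter.dupNamespace false

/-! ## Essential suprema versus pointwise values -/

/-- ESS-SUP BOUND + CONTINUITY ⇒ POINTWISE BOUND: if `‖f‖ₑ ≤ ε` a.e. on `S` (restricted Lebesgue
measure) and `f` is continuous on an open `U ⊆ S`, then `‖f z‖ ≤ ε` on `U` (else `U ∩ {‖f‖ > ε}`
is open and non-null).  Non-strict twin of `RellichScarScarRigidity.norm_le_of_ae_lt`. [folklore] -/
theorem norm_le_of_ae_enorm_le {S U : Set (ℝ × EuclideanSpace ℝ (Fin 3))}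
    {f : ℝ × EuclideanSpace ℝ (Fin 3) → EuclideanSpace ℝ (Fin 3)} {ε : ℝ} (hε : 0 ≤ ε)
    (hU : IsOpen U) (hUS : U ⊆ S) (hf : ContinuousOn f U)
    (hsmall : ∀ᵐ z ∂(volume.restrict S), ‖f z‖ₑ ≤ ENNReal.ofReal ε)
    {z : ℝ × EuclideanSpace ℝ (Fin 3)} (hz : z ∈ U) : ‖f z‖ ≤ ε := by
  by_contra hcon
  set A : Set (ℝ × EuclideanSpace ℝ (Fin 3)) := U ∩ (fun z => ‖f z‖) ⁻¹' Ioi ε with hA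
  have hAopen : IsOpen A := (hf.norm).isOpen_inter_preimage hU isOpen_Ioi
  have hApos : 0 < volume A := hAopen.measure_pos volume ⟨z, ⟨hz, not_le.1 hcon⟩⟩
  have hnull : volume.restrict S A = 0 := by
    refine measure_eq_zero_iff_ae_notMem.2 ?_
    filter_upwards [hsmall] with y hy hyA
    have h2 : ε < ‖f y‖ := hyA.2
    have h1 : ENNReal.ofReal ε < ‖f y‖ₑ := by
      rw [← ofReal_norm]
      exact (ENNReal.ofReal_lt_ofReal_iff (hε.trans_lt h2)).2 h2
    exact lt_irrefl _ (h1.trans_le hy)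
  rw [Measure.restrict_apply hAopen.measurableSet,
    inter_eq_left.2 (fun y hy => hUS hy.1 : A ⊆ S)] at hnull
  exact absurd hnull hApos.ne'

/-- An `L^∞` bound is an a.e. bound. [folklore] -/
theorem ae_enorm_le_of_eLpNorm_top_le {α : Type*} {m : MeasurableSpace α} {μ : Measure α}
    {f : α → EuclideanSpace ℝ (Fin 3)} {b : ℝ≥0∞} (h : eLpNorm f ⊤ μ ≤ b) :
    ∀ᵐ z ∂μ, ‖f z‖ₑ ≤ b := by
  rw [eLpNorm_exponent_top] at h
  filter_upwards [ae_le_eLpNormEssSup (f := f) (μ := μ)] with z hz using hz.trans h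

/-- **Flatness passes to the limit of the static traces.**  Let `F j` be fields continuous on the
open slab `t < 0` with static traces `τ j` at the uniform rate `‖F j (t,x) − τ j x‖ ≤ M(−t)/‖x‖³`,
and let `τ j → τl` pointwise off the origin.  If for every compact `K ∌ 0` and `ε > 0`,
eventually in `j`, `‖F j‖_{L^∞((−δ,0)×K)} ≤ ε` for all small `δ > 0`, then `τl = 0` off the
origin: on the open box `(−δ,0) × B(x,‖x‖/2)` the essential bound is a pointwise one, `t ↑ 0`
gives `‖τ j x‖ ≤ ε`, and `j → ∞` gives `‖τl x‖ ≤ ε`. [folklore] -/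
theorem static_limit_eq_zero_of_flat
    {F : ℕ → ℝ × EuclideanSpace ℝ (Fin 3) → EuclideanSpace ℝ (Fin 3)}
    {τ : ℕ → EuclideanSpace ℝ (Fin 3) → EuclideanSpace ℝ (Fin 3)}
    {τl : EuclideanSpace ℝ (Fin 3) → EuclideanSpace ℝ (Fin 3)} {M : ℝ}
    (hcont : ∀ j, ContinuousOn (F j) (Iio (0 : ℝ) ×ˢ (univ : Set (EuclideanSpace ℝ (Fin 3)))))
    (hrate : ∀ j, ∀ t < (0 : ℝ), ∀ x : EuclideanSpace ℝ (Fin 3), x ≠ 0 →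
      ‖F j (t, x) - τ j x‖ ≤ M * (-t) / ‖x‖ ^ 3)
    (hlim : ∀ x : EuclideanSpace ℝ (Fin 3), x ≠ 0 → Tendsto (fun j => τ j x) atTop (𝓝 (τl x)))
    (hflat : ∀ K : Set (EuclideanSpace ℝ (Fin 3)), IsCompact K →
      (0 : EuclideanSpace ℝ (Fin 3)) ∉ K → ∀ ε : ℝ, 0 < ε → ∀ᶠ j in atTop,
      ∀ᶠ δ in 𝓝[>] (0 : ℝ),
        eLpNorm (F j) ⊤ (volume.restrict (Ioo (-δ) 0 ×ˢ K)) ≤ ENNReal.ofReal ε)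
    {x : EuclideanSpace ℝ (Fin 3)} (hx : x ≠ 0) : τl x = 0 := by
  rw [← norm_le_zero_iff]
  refine le_of_forall_pos_le_add fun ε hε => ?_
  rw [zero_add]
  have hxpos : 0 < ‖x‖ := norm_pos_iff.2 hx
  set K : Set (EuclideanSpace ℝ (Fin 3)) := closedBall x (‖x‖ / 2) with hK
  have h0K : (0 : EuclideanSpace ℝ (Fin 3)) ∉ K := fun h0 => by
    have : dist (0 : EuclideanSpace ℝ (Fin 3)) x ≤ ‖x‖ / 2 := mem_closedBall.1 h0
    rw [dist_eq_norm, zero_sub, norm_neg] at this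
    linarith
  have hj : ∀ᶠ j in atTop, ‖τ j x‖ ≤ ε := by
    filter_upwards [hflat K (isCompact_closedBall _ _) h0K ε hε] with j hjδ
    obtain ⟨δ, hδN, hδpos⟩ := (hjδ.and self_mem_nhdsWithin).exists
    have hδ0 : (0 : ℝ) < δ := hδpos
    set S : Set (ℝ × EuclideanSpace ℝ (Fin 3)) := Ioo (-δ) 0 ×ˢ K with hS
    have hSsub : S ⊆ Iio (0 : ℝ) ×ˢ (univ : Set (EuclideanSpace ℝ (Fin 3))) :=
      prod_mono Ioo_subset_Iio_self (subset_univ _)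
    have hae : ∀ᵐ z ∂(volume.restrict S), ‖F j z‖ₑ ≤ ENNReal.ofReal ε :=
      ae_enorm_le_of_eLpNorm_top_le hδN
    set U : Set (ℝ × EuclideanSpace ℝ (Fin 3)) := Ioo (-δ) 0 ×ˢ ball x (‖x‖ / 2) with hU
    have hUS : U ⊆ S := prod_mono Subset.rfl ball_subset_closedBall
    have hw : ContinuousOn (F j) U := (hcont j).mono (hUS.trans hSsub)
    have hpt : ∀ t ∈ Ioo (-δ) (0 : ℝ), ‖F j (t, x)‖ ≤ ε := fun t ht =>
      norm_le_of_ae_enorm_le hε.le (isOpen_Ioo.prod isOpen_ball) hUS hw hae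
        (mk_mem_prod ht (mem_ball_self (half_pos hxpos)))
    have hbound : ∀ t ∈ Ioo (-δ) (0 : ℝ), ‖τ j x‖ ≤ ε + M * (-t) / ‖x‖ ^ 3 := by
      intro t ht
      calc ‖τ j x‖ = ‖F j (t, x) - (F j (t, x) - τ j x)‖ := by rw [sub_sub_cancel]
        _ ≤ ‖F j (t, x)‖ + ‖F j (t, x) - τ j x‖ := norm_sub_le _ _
        _ ≤ ε + M * (-t) / ‖x‖ ^ 3 := add_le_add (hpt t ht) (hrate j t ht.2 x hx)
    have htend : Tendsto (fun t : ℝ => ε + M * (-t) / ‖x‖ ^ 3) (𝓝[<] 0) (𝓝 ε) := by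
      have : Tendsto (fun t : ℝ => ε + M * (-t) / ‖x‖ ^ 3) (𝓝 0)
          (𝓝 (ε + M * (-0) / ‖x‖ ^ 3)) :=
        (continuous_const.add ((continuous_const.mul continuous_neg).div_const _)).tendsto 0
      rw [neg_zero, mul_zero, zero_div, add_zero] at this
      exact this.mono_left nhdsWithin_le_nhds
    refine ge_of_tendsto htend ?_
    filter_upwards [Ioo_mem_nhdsLT (show -δ < (0 : ℝ) by linarith)] with t ht using hbound t ht
  exact le_of_tendsto (hlim x hx).norm hj

/-- **Pointwise convergence of fields passes to their static traces**: if `W j → U` pointwise on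
`t < 0` and `W j`, `U` have the traces `σ j`, `σl` at the uniform rate `L(−t)/‖x‖³`, then
`σ j → σl` pointwise off the origin (choose `t` close to `0`, then `j` large). [folklore] -/
theorem tendsto_static_of_tendsto
    {W : ℕ → ℝ → EuclideanSpace ℝ (Fin 3) → EuclideanSpace ℝ (Fin 3)}
    {U : ℝ → EuclideanSpace ℝ (Fin 3) → EuclideanSpace ℝ (Fin 3)}
    {σ : ℕ → EuclideanSpace ℝ (Fin 3) → EuclideanSpace ℝ (Fin 3)}
    {σl : EuclideanSpace ℝ (Fin 3) → EuclideanSpace ℝ (Fin 3)} {L : ℝ}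
    (hW : ∀ j, ∀ t < (0 : ℝ), ∀ x : EuclideanSpace ℝ (Fin 3), x ≠ 0 →
      ‖W j t x - σ j x‖ ≤ L * (-t) / ‖x‖ ^ 3)
    (hU : ∀ t < (0 : ℝ), ∀ x : EuclideanSpace ℝ (Fin 3), x ≠ 0 →
      ‖U t x - σl x‖ ≤ L * (-t) / ‖x‖ ^ 3)
    (hlim : ∀ t < (0 : ℝ), ∀ x : EuclideanSpace ℝ (Fin 3),
      Tendsto (fun j => W j t x) atTop (𝓝 (U t x)))
    {x : EuclideanSpace ℝ (Fin 3)} (hx : x ≠ 0) :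
    Tendsto (fun j => σ j x) atTop (𝓝 (σl x)) := by
  rw [Metric.tendsto_nhds]
  intro ε hε
  have hrt : Tendsto (fun t : ℝ => L * (-t) / ‖x‖ ^ 3) (𝓝[<] 0) (𝓝 0) := by
    have : Tendsto (fun t : ℝ => L * (-t) / ‖x‖ ^ 3) (𝓝 0) (𝓝 (L * (-0) / ‖x‖ ^ 3)) :=
      ((continuous_const.mul continuous_neg).div_const _).tendsto 0
    rw [neg_zero, mul_zero, zero_div] at this
    exact this.mono_left nhdsWithin_le_nhds
  have hev : ∀ᶠ t in 𝓝[<] (0 : ℝ), L * (-t) / ‖x‖ ^ 3 < ε / 4 :=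
    (tendsto_order.1 hrt).2 _ (by positivity)
  obtain ⟨t, ht4, ht0⟩ := (hev.and self_mem_nhdsWithin).exists
  have ht0 : t < 0 := ht0
  have hj : ∀ᶠ j in atTop, dist (W j t x) (U t x) < ε / 2 :=
    Metric.tendsto_nhds.1 (hlim t ht0 x) _ (half_pos hε)
  filter_upwards [hj] with j hj
  rw [dist_eq_norm] at hj ⊢
  have h1 := hW j t ht0 x hx
  have h2 := hU t ht0 x hx
  have h3 : ‖σ j x - σl x‖ ≤ ‖W j t x - U t x‖ + ‖W j t x - σ j x‖ + ‖U t x - σl x‖ := by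
    calc ‖σ j x - σl x‖ = ‖(W j t x - U t x) - (W j t x - σ j x) + (U t x - σl x)‖ := by
          congr 1; abel
      _ ≤ ‖(W j t x - U t x) - (W j t x - σ j x)‖ + ‖U t x - σl x‖ := norm_add_le _ _
      _ ≤ ‖W j t x - U t x‖ + ‖W j t x - σ j x‖ + ‖U t x - σl x‖ := by
          gcongr; exact norm_sub_le _ _
  linarith

/-- **A cubic rate gives a zero scar functional**: if `‖D(t,x)‖ ≤ M(−t)/‖x‖³` on `t < 0`,
`x ≠ 0` (`M ≥ 0`), then `‖D‖_{L^∞((−δ,0)×K)} ≤ Mδ/ρ³ → 0` as `δ ↓ 0` for every compact `K ∌ 0`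
(`ρ = dist(0, K) > 0`). [folklore] -/
theorem tendsto_eLpNorm_top_of_rate {D : ℝ × EuclideanSpace ℝ (Fin 3) → EuclideanSpace ℝ (Fin 3)}
    {M : ℝ} (hM : 0 ≤ M)
    (hD : ∀ t < (0 : ℝ), ∀ x : EuclideanSpace ℝ (Fin 3), x ≠ 0 →
      ‖D (t, x)‖ ≤ M * (-t) / ‖x‖ ^ 3)
    {K : Set (EuclideanSpace ℝ (Fin 3))} (hK : IsCompact K)
    (h0 : (0 : EuclideanSpace ℝ (Fin 3)) ∉ K) :
    Tendsto (fun δ : ℝ => eLpNorm D ⊤ (volume.restrict (Ioo (-δ) 0 ×ˢ K))) (𝓝[>] 0) (𝓝 0) := by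
  obtain ⟨ρ, hρ, hKρ⟩ := exists_pos_le_norm_of_isCompact hK h0
  have hg : Tendsto (fun δ : ℝ => ENNReal.ofReal (M * δ / ρ ^ 3)) (𝓝[>] 0) (𝓝 0) := by
    have h1 : Tendsto (fun δ : ℝ => M * δ / ρ ^ 3) (𝓝 0) (𝓝 (M * 0 / ρ ^ 3)) :=
      ((continuous_const.mul continuous_id).div_const _).tendsto 0
    rw [mul_zero, zero_div] at h1
    have h2 := ENNReal.tendsto_ofReal h1
    rw [ENNReal.ofReal_zero] at h2
    exact h2.mono_left nhdsWithin_le_nhds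
  refine tendsto_of_tendsto_of_tendsto_of_le_of_le' tendsto_const_nhds hg
    (Eventually.of_forall fun _ => bot_le) ?_
  filter_upwards [self_mem_nhdsWithin] with δ hδ
  have hδ0 : (0 : ℝ) < δ := hδ
  rw [eLpNorm_exponent_top]
  refine eLpNormEssSup_le_of_ae_bound ?_
  filter_upwards [ae_restrict_mem (measurableSet_Ioo.prod hK.measurableSet)] with z hz
  obtain ⟨⟨hz1, hz2⟩, hzK⟩ := hz
  have hzρ := hKρ z.2 hzK
  have hz0 : z.2 ≠ 0 := fun h => by
    rw [h, norm_zero] at hzρ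
    linarith
  calc ‖D z‖ = ‖D (z.1, z.2)‖ := rfl
    _ ≤ M * (-z.1) / ‖z.2‖ ^ 3 := hD z.1 hz2 z.2 hz0
    _ ≤ M * δ / ρ ^ 3 := by
        have h1 : M * (-z.1) ≤ M * δ := mul_le_mul_of_nonneg_left (by linarith) hM
        have h2 : ρ ^ 3 ≤ ‖z.2‖ ^ 3 := pow_le_pow_left₀ hρ.le hzρ 3
        exact div_le_div₀ (mul_nonneg hM hδ0.le) h1 (pow_pos hρ 3) h2

/-! ## A.e. bookkeeping on the slab -/

/-- The scar functional does not see modifications on null sets of the slab. [folklore] -/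
theorem eLpNorm_scar_congr_ae {f f' g g' : ℝ → EuclideanSpace ℝ (Fin 3) → EuclideanSpace ℝ (Fin 3)}
    (hf : uncurry f =ᵐ[volume.restrict (Iio (0 : ℝ) ×ˢ (univ : Set (EuclideanSpace ℝ (Fin 3))))]
      uncurry f')
    (hg : uncurry g =ᵐ[volume.restrict (Iio (0 : ℝ) ×ˢ (univ : Set (EuclideanSpace ℝ (Fin 3))))]
      uncurry g')
    (δ : ℝ) (K : Set (EuclideanSpace ℝ (Fin 3))) :
    eLpNorm (uncurry f - uncurry g) ⊤ (volume.restrict (Ioo (-δ) 0 ×ˢ K)) =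
      eLpNorm (uncurry f' - uncurry g') ⊤ (volume.restrict (Ioo (-δ) 0 ×ˢ K)) := by
  refine eLpNorm_congr_ae ?_
  have hsub : Ioo (-δ) (0 : ℝ) ×ˢ K ⊆ Iio (0 : ℝ) ×ˢ (univ : Set (EuclideanSpace ℝ (Fin 3))) :=
    prod_mono Ioo_subset_Iio_self (subset_univ _)
  have hf' : uncurry f =ᵐ[volume.restrict (Ioo (-δ) 0 ×ˢ K)] uncurry f' :=
    ae_restrict_of_ae_restrict_of_subset hsub hf
  have hg' : uncurry g =ᵐ[volume.restrict (Ioo (-δ) 0 ×ˢ K)] uncurry g' :=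
    ae_restrict_of_ae_restrict_of_subset hsub hg
  exact hf'.sub hg'

/-- `SameScar` does not see modifications on null sets of the slab. [folklore] -/
theorem sameScar_congr_ae {f f' g g' : ℝ → EuclideanSpace ℝ (Fin 3) → EuclideanSpace ℝ (Fin 3)}
    (hf : uncurry f =ᵐ[volume.restrict (Iio (0 : ℝ) ×ˢ (univ : Set (EuclideanSpace ℝ (Fin 3))))]
      uncurry f')
    (hg : uncurry g =ᵐ[volume.restrict (Iio (0 : ℝ) ×ˢ (univ : Set (EuclideanSpace ℝ (Fin 3))))]
      uncurry g') :
    SameScar f g ↔ SameScar f' g' := by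
  unfold SameScar
  simp_rw [eLpNorm_scar_congr_ae hf hg]

/-! ## The abstract defect-limit lemma (registered sub-goal of `stub_scarDefectLimit`) -/

/-- **Abstract scar-defect limit.**  `T` is an operation on fields, `T'` the induced operation on
static fields: `T` preserves continuity on the open slab, transports the cubic trace rate
(`V → s` at rate `L` implies `T V → T' s` at rate `L`) and `T'` is continuous for pointwise
convergence off the origin.  If `W j`, `U` have traces `σ j → σU` (rate `L`, pointwise
convergence off the origin) and the `T`-defect of `W j` is asymptotically flat on every compact
`K ∌ 0`, then `T' σU = σU` off the origin (`static_limit_eq_zero_of_flat` for the defects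
`T(W j) − W j`, traces `T'(σ j) − σ j`, rate `2L`), whence `‖T U − U‖ ≤ 2L(−t)/‖x‖³` and
`SameScar (T U) U` (`tendsto_eLpNorm_top_of_rate`). [folklore] -/
theorem sameScar_of_flat_defect :
    ∀ (T : (ℝ → EuclideanSpace ℝ (Fin 3) → EuclideanSpace ℝ (Fin 3)) →
        ℝ → EuclideanSpace ℝ (Fin 3) → EuclideanSpace ℝ (Fin 3))
      (T' : (EuclideanSpace ℝ (Fin 3) → EuclideanSpace ℝ (Fin 3)) →
        EuclideanSpace ℝ (Fin 3) → EuclideanSpace ℝ (Fin 3))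
      (L : ℝ) (W : ℕ → ℝ → EuclideanSpace ℝ (Fin 3) → EuclideanSpace ℝ (Fin 3))
      (U : ℝ → EuclideanSpace ℝ (Fin 3) → EuclideanSpace ℝ (Fin 3))
      (σ : ℕ → EuclideanSpace ℝ (Fin 3) → EuclideanSpace ℝ (Fin 3))
      (σU : EuclideanSpace ℝ (Fin 3) → EuclideanSpace ℝ (Fin 3)),
      0 ≤ L →
      (∀ V : ℝ → EuclideanSpace ℝ (Fin 3) → EuclideanSpace ℝ (Fin 3),
        ContinuousOn (uncurry V) (Iio (0 : ℝ) ×ˢ univ) →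
        ContinuousOn (uncurry (T V)) (Iio (0 : ℝ) ×ˢ univ)) →
      (∀ (V : ℝ → EuclideanSpace ℝ (Fin 3) → EuclideanSpace ℝ (Fin 3))
          (s : EuclideanSpace ℝ (Fin 3) → EuclideanSpace ℝ (Fin 3)),
        (∀ t : ℝ, t < 0 → ∀ x : EuclideanSpace ℝ (Fin 3), x ≠ 0 →
          ‖V t x - s x‖ ≤ L * (-t) / ‖x‖ ^ 3) →
        ∀ t : ℝ, t < 0 → ∀ x : EuclideanSpace ℝ (Fin 3), x ≠ 0 →
          ‖T V t x - T' s x‖ ≤ L * (-t) / ‖x‖ ^ 3) →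
      (∀ (s : ℕ → EuclideanSpace ℝ (Fin 3) → EuclideanSpace ℝ (Fin 3))
          (sl : EuclideanSpace ℝ (Fin 3) → EuclideanSpace ℝ (Fin 3)),
        (∀ x : EuclideanSpace ℝ (Fin 3), x ≠ 0 → Tendsto (fun j => s j x) atTop (𝓝 (sl x))) →
        ∀ x : EuclideanSpace ℝ (Fin 3), x ≠ 0 →
          Tendsto (fun j => T' (s j) x) atTop (𝓝 (T' sl x))) →
      (∀ j : ℕ, ContinuousOn (uncurry (W j)) (Iio (0 : ℝ) ×ˢ univ)) →
      (∀ j : ℕ, ∀ t : ℝ, t < 0 → ∀ x : EuclideanSpace ℝ (Fin 3), x ≠ 0 →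
        ‖W j t x - σ j x‖ ≤ L * (-t) / ‖x‖ ^ 3) →
      (∀ t : ℝ, t < 0 → ∀ x : EuclideanSpace ℝ (Fin 3), x ≠ 0 →
        ‖U t x - σU x‖ ≤ L * (-t) / ‖x‖ ^ 3) →
      (∀ x : EuclideanSpace ℝ (Fin 3), x ≠ 0 → Tendsto (fun j => σ j x) atTop (𝓝 (σU x))) →
      (∀ K : Set (EuclideanSpace ℝ (Fin 3)), IsCompact K → (0 : EuclideanSpace ℝ (Fin 3)) ∉ K →
        ∀ ε : ℝ, 0 < ε → ∀ᶠ j in atTop, ∀ᶠ δ in 𝓝[>] (0 : ℝ),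
          eLpNorm (uncurry (T (W j)) - uncurry (W j)) ⊤ (volume.restrict (Ioo (-δ) 0 ×ˢ K)) ≤
            ENNReal.ofReal ε) →
      SameScar (T U) U := by
  intro T T' L W U σ σU hL hTcont hTrate hT'lim hWcont hWrate hUrate hσlim hflat
  -- Step 1: the limit trace is `T'`-invariant off the origin
  have hfix : ∀ x : EuclideanSpace ℝ (Fin 3), x ≠ 0 → T' σU x - σU x = 0 := by
    intro x hx
    refine static_limit_eq_zero_of_flat (F := fun j => uncurry (T (W j)) - uncurry (W j))
      (τ := fun j x => T' (σ j) x - σ j x) (τl := fun x => T' σU x - σU x) (M := L + L)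
      (fun j => ((hTcont _ (hWcont j)).sub (hWcont j))) ?_ ?_ hflat hx
    · intro j t ht y hy
      have h1 := hTrate (W j) (σ j) (hWrate j) t ht y hy
      have h2 := hWrate j t ht y hy
      calc ‖(uncurry (T (W j)) - uncurry (W j)) (t, y) - (T' (σ j) y - σ j y)‖
          = ‖(T (W j) t y - T' (σ j) y) - (W j t y - σ j y)‖ := by
            congr 1
            show (T (W j) t y - W j t y) - (T' (σ j) y - σ j y) = _
            abel
        _ ≤ ‖T (W j) t y - T' (σ j) y‖ + ‖W j t y - σ j y‖ := norm_sub_le _ _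
        _ ≤ L * (-t) / ‖y‖ ^ 3 + L * (-t) / ‖y‖ ^ 3 := add_le_add h1 h2
        _ = (L + L) * (-t) / ‖y‖ ^ 3 := by ring
    · intro y hy
      exact (hT'lim σ σU hσlim y hy).sub (hσlim y hy)
  -- Step 2: the defect of the limit has the cubic rate, hence a zero scar functional
  intro K hK h0
  refine tendsto_eLpNorm_top_of_rate (D := uncurry (T U) - uncurry U) (M := L + L) (by positivity)
    ?_ hK h0
  intro t ht x hx
  have h1 := hTrate U σU hUrate t ht x hx
  have h2 := hUrate t ht x hx
  have h3 : T' σU x = σU x := sub_eq_zero.1 (hfix x hx)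
  calc ‖(uncurry (T U) - uncurry U) (t, x)‖ = ‖(T U t x - T' σU x) - (U t x - σU x)‖ := by
        congr 1
        show T U t x - U t x = _
        rw [h3]
        abel
    _ ≤ ‖T U t x - T' σU x‖ + ‖U t x - σU x‖ := norm_sub_le _ _
    _ ≤ L * (-t) / ‖x‖ ^ 3 + L * (-t) / ‖x‖ ^ 3 := add_le_add h1 h2
    _ = (L + L) * (-t) / ‖x‖ ^ 3 := by ring

end Summit.NavierStokesRegularity.NavierStokesRegularity.Theorems.SymmetricScarExists.ScarWindow

end
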